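import Summits.Ventures.Crystal3D.Theorems.StickyWulffConstantCoaxialWallLawSeamGlideCensusSoundB
import HarnessLib

/-!
# GLIDE-CENSUS SOUNDNESS, part C: the pocket leaf and `runG_sound`
# (crux `CoaxialWallLaw`, stmt-Ventures-19481; lane F 'Certificates' v8.7, registered stub `stub_satCensus11Glide : TailResidue.SatCensus11Glide`)

HONEST FRAMING. Venture `Summits/Ventures/Crystal3D` (cell `crystal3d-full`); helper for `stub_satCensus11Glide`; sequel of '…SeamGlideCensusSoundB' (seat 19481-p2 g16).
* `exists_unknown_saturated` — in an interpreted state with at most ten known contacts of the end ball (nine if no unsaturated contact is designated), some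
  contact of the end ball is not a known ball and has twelve contacts (degree 11 + «at most one unsaturated contact»);
* **`false_of_pocketG`** — the POCKET LEAF: the state contains an isometric copy (reflection chain) of one of the two cavity templates with every template pin decided;
  the undecided saturated contact `c` of the end ball then satisfies the hypotheses of the pocket row (GAP(5/2) at `c` against every template ball; GAP at the
  template's saturated balls against the further contacts of `c`), so `GlidePocketCap` bounds its degree by eleven — contradiction;
* **`runG_sound`** — no certificate is accepted from a state interpreted in `X` (induction on the certificate; E1 via `e1_step`, splits, presence splits, the four leaf kinds).
WHAT THIS IS NOT: no certificate is checked here; the inputs stay named; F-C1 not moved.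
-/

noncomputable section

namespace Summit.Ventures.Crystal3D.Theorems

namespace TailResidue

namespace GlideCensus

open Summit.Ventures.Crystal3D Finset EndRowFloor NearIdentity FullCensus
open scoped InnerProductSpace

variable {X : Finset (EuclideanSpace ℝ (Fin 3))} {G' : EuclideanSpace ℝ (Fin 3) ≃ₗᵢ[ℝ] EuclideanSpace ℝ (Fin 3)} {q₀ : EuclideanSpace ℝ (Fin 3)}

attribute [local irreducible] insertV addAll fullList ownList mirList farList tabs

/-! ### §8b The pocket leaf -/

open scoped Classical in
/-- In an interpreted state whose known contacts of the end ball number at most ten (nine if no unsaturated contact is designated), some contact of the end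
ball is NOT a known ball and is saturated. -/
theorem exists_unknown_saturated (hyp : HypG X G' q₀) {st : St} (hinv : InvG X G' q₀ st)
    (hcount : (match st.uns with | some _ => decide (knownContacts st ≤ 10) | none => decide (knownContacts st ≤ 9)) = true) :
    ∃ c ∈ X, dist c (TT G' q₀ bG) = 1 ∧ (∀ p ∈ st.pres, c ≠ TT G' q₀ p) ∧ (X.filter fun z => dist c z = 1).card = 12 := by
  set C := X.filter fun z => dist (TT G' q₀ bG) z = 1 with hC
  set KC := st.pres.filter fun v => decide (Q3.d2 bG v = 18) with hKC
  set I := (KC.map (TT G' q₀)).toFinset with hI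
  have hIcard : I.card = knownContacts st := by
    rw [hI, List.card_toFinset, ((List.nodup_map_iff (TT_injective G' q₀)).2 (hinv.nodup.filter _)).dedup, List.length_map]; rfl
  have hIC : I ⊆ C := by
    intro z hz
    rw [hI, List.mem_toFinset, List.mem_map] at hz
    obtain ⟨v, hv, rfl⟩ := hz
    obtain ⟨hvp, hvd⟩ := List.mem_filter.1 hv
    exact mem_filter.2 ⟨hinv.pres v hvp, (dist_TT_eq_one_iff G' q₀ bG v).2 (of_decide_eq_true hvd)⟩
  -- a contact outside `I` is not a known ball
  have hnew : ∀ c ∈ C, c ∉ I → ∀ p ∈ st.pres, c ≠ TT G' q₀ p := by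
    intro c hc hcI p hp hcp
    apply hcI
    rw [hI, List.mem_toFinset, List.mem_map]
    refine ⟨p, List.mem_filter.2 ⟨hp, decide_eq_true ((dist_TT_eq_one_iff G' q₀ bG p).1 ?_)⟩, hcp.symm⟩
    rw [← hcp]; exact (mem_filter.1 hc).2
  have h12of : ∀ c ∈ C, ¬ (X.filter fun z => dist c z = 1).card ≤ 11 → (X.filter fun z => dist c z = 1).card = 12 := by
    intro c hc h
    have := card_filter_dist_eq_one_le_twelve X hyp.sep c; omega
  cases hu : st.uns with
  | some u =>
    rw [hu] at hcount
    have hk : knownContacts st ≤ 10 := of_decide_eq_true hcount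
    have hlt : I.card < C.card := by rw [hIcard, hC, hyp.deg]; omega
    obtain ⟨c, hcC, hcI⟩ := exists_mem_notMem_of_card_lt_card hlt
    obtain ⟨hcX, hcd⟩ := mem_filter.1 hcC
    obtain ⟨hup, hud, hule⟩ := hinv.uns u hu
    refine ⟨c, hcX, by rw [dist_comm]; exact hcd, hnew c hcC hcI, h12of c hcC fun hle => ?_⟩
    have heq := hyp.one c hcX _ (hinv.pres u hup) hcd ((dist_TT_eq_one_iff G' q₀ bG u).2 hud) hle hule
    exact hnew c hcC hcI u hup heq
  | none =>
    rw [hu] at hcount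
    have hk : knownContacts st ≤ 9 := of_decide_eq_true hcount
    have hlt : I.card + 1 < C.card := by rw [hIcard, hC, hyp.deg]; omega
    -- two contacts outside `I`
    have hsd : 1 < (C \ I).card := by
      have := card_sdiff_add_card_inter C I
      have h2 : (C ∩ I).card ≤ I.card := card_le_card inter_subset_right
      omega
    obtain ⟨c₁, hc₁, c₂, hc₂, hne⟩ := one_lt_card.1 hsd
    obtain ⟨hc₁C, hc₁I⟩ := mem_sdiff.1 hc₁
    obtain ⟨hc₂C, hc₂I⟩ := mem_sdiff.1 hc₂
    obtain ⟨hc₁X, hc₁d⟩ := mem_filter.1 hc₁C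
    obtain ⟨hc₂X, hc₂d⟩ := mem_filter.1 hc₂C
    by_cases h₁ : (X.filter fun z => dist c₁ z = 1).card ≤ 11
    · refine ⟨c₂, hc₂X, by rw [dist_comm]; exact hc₂d, hnew c₂ hc₂C hc₂I, h12of c₂ hc₂C fun h₂ => ?_⟩
      exact hne (hyp.one c₁ hc₁X c₂ hc₂X hc₁d hc₂d h₁ h₂)
    · exact ⟨c₁, hc₁X, by rw [dist_comm]; exact hc₁d, hnew c₁ hc₁C hc₁I, h12of c₁ hc₁C h₁⟩

open scoped Classical in
/-- **THE POCKET LEAF.**  The state contains (an isometric copy of) one of the two cavity templates, with every template pin position decided; the end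
ball has an undecided contact `c`, which is saturated and a pocket ball of the template — contradicting `GlidePocketCap`. -/
theorem false_of_pocketG (hyp : HypG X G' q₀) {st : St} (hinv : InvG X G' q₀ st) {tid : ℕ} {ns : List Q3}
    (h : runG (.pocket tid ns) st = true) : False := by
  simp only [runG, Bool.and_eq_true, decide_eq_true_eq] at h
  obtain ⟨⟨⟨⟨htid, hns'⟩, hobst⟩, hpins⟩, hcount⟩ := h
  have hrow : PocketRow (pocketObst tid) (pocketPins tid) := by
    rcases Nat.lt_succ_iff.1 htid |>.lt_or_eq with h0 | h1
    · have : tid = 0 := by omega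
      subst this; exact hyp.pocket.1
    · subst h1; exact hyp.pocket.2
  obtain ⟨c, hcX, hcb, hcnew, hc12⟩ := exists_unknown_saturated hyp hinv hcount
  set z := TT G' q₀ bG with hz
  set A := AofChain G' ns with hA
  -- placed template positions are model balls
  have hpos : ∀ v : Q3, z + A (Qr (iptQ v.toV)) = TT G' q₀ (Q3.add bG (msymQ ns v)) := fun v => TT_add_msymQ hns' bG v
  simp only [List.all_eq_true] at hobst hpins
  -- obstacle facts
  have hobX : ∀ ok ∈ pocketObst tid, Q3.add bG (msymQ ns ok.1) ∈ st.pres ∧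
      ((ok.2 = 0 ∨ ok.2 = 1) → Q3.add bG (msymQ ns ok.1) ∈ st.sat) ∧ (ok.2 = 0 → ∃ pd ∈ st.dzn, pd.1 = Q3.add bG (msymQ ns ok.1)) := by
    intro ok hok
    have h := hobst ok hok
    set P := Q3.add bG (msymQ ns ok.1)
    have hdzn : (st.dzn.any fun pd => decide (pd.1 = P)) = true → ∃ pd ∈ st.dzn, pd.1 = P := by
      intro hh; simp only [List.any_eq_true, decide_eq_true_eq] at hh; exact hh
    by_cases hk0 : ok.2 = 0
    · rw [hk0, obstOK, if_pos rfl] at h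
      obtain ⟨pd, hpd, hpd1⟩ := hdzn h
      have hsat : P ∈ st.sat := hpd1 ▸ hinv.dznSat pd hpd
      exact ⟨hinv.satPres _ hsat, fun _ => hsat, fun _ => ⟨pd, hpd, hpd1⟩⟩
    by_cases hk1 : ok.2 = 1
    · rw [hk1, obstOK, if_neg (by decide), if_pos rfl, Bool.or_eq_true, decide_eq_true_eq] at h
      have hsat : P ∈ st.sat := by
        rcases h with h | h
        · exact h
        · obtain ⟨pd, hpd, hpd1⟩ := hdzn h; exact hpd1 ▸ hinv.dznSat pd hpd
      exact ⟨hinv.satPres _ hsat, fun _ => hsat, fun h0 => absurd (hk1 ▸ h0 : (1 : ℕ) = 0) (by decide)⟩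
    by_cases hk2 : ok.2 = 2
    · rw [hk2, obstOK, if_neg (by decide), if_neg (by decide), if_pos rfl, decide_eq_true_eq] at h
      exact ⟨h, fun hne => by rcases hne with h' | h' <;> omega, fun h0 => absurd (hk2 ▸ h0 : (2 : ℕ) = 0) (by decide)⟩
    · rw [obstOK, if_neg hk0, if_neg hk1, if_neg hk2] at h
      exact absurd h Bool.false_ne_true
  -- apply the row
  set N := (X.filter fun x => dist x c = 1) \ (insert z (((pocketObst tid).map fun ok => TT G' q₀ (Q3.add bG (msymQ ns ok.1))).toFinset)) with hN
  have hzc : dist c z = 1 := hcb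
  have hcob : ∀ ok ∈ pocketObst tid, c ≠ z + A (Qr (iptQ ok.1.toV)) ∧ ObstCond ok.2 (dist c (z + A (Qr (iptQ ok.1.toV)))) := by
    intro ok hok
    rw [hpos]
    obtain ⟨hP, hPsat, hPdzn⟩ := hobX ok hok
    have hne : c ≠ TT G' q₀ (Q3.add bG (msymQ ns ok.1)) := hcnew _ hP
    refine ⟨hne, ?_⟩
    unfold ObstCond
    split_ifs with h0
    · -- known dozen: not a contact of it, hence gap
      obtain ⟨pd, hpd, hpd1⟩ := hPdzn h0
      obtain ⟨⟨hPX, hP12⟩, hcont⟩ := hinv.dzn pd hpd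
      rw [hpd1] at hPX hP12 hcont
      rcases eq_or_dist_eq_one_or_le_dist_of_saturated hyp.gap hyp.sep hPX hP12 hcX with h | h | h
      · exact absurd h hne
      · obtain ⟨u, hu, hcu⟩ := hcont c hcX h
        exact absurd hcu (hcnew u (hinv.dznPres pd hpd u hu))
      · rw [dist_comm]; linarith
    · -- GAP at the saturated pocket ball `c`
      rcases eq_or_dist_eq_one_or_le_dist_of_saturated hyp.gap hyp.sep hcX hc12 (hinv.pres _ hP) with h | h | h
      · exact absurd h.symm hne
      · exact Or.inl h
      · exact Or.inr (by linarith)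
  have hcpin : ∀ e ∈ pocketPins tid, c ≠ z + A (Qr (iptQ e.toV)) := by
    intro e he
    rw [hpos]
    rcases (by simpa using hpins e he : Q3.add bG (msymQ ns e) ∈ st.emp ∨ Q3.add bG (msymQ ns e) ∈ st.pres) with h | h
    · exact fun hce => hinv.emp _ h (hce ▸ hcX)
    · exact hcnew _ h
  have hNmem : ∀ x ∈ N, x ∈ X ∧ dist x c = 1 ∧ x ≠ z ∧ ∀ ok ∈ pocketObst tid, x ≠ TT G' q₀ (Q3.add bG (msymQ ns ok.1)) := by
    intro x hx
    obtain ⟨hx1, hx2⟩ := mem_sdiff.1 hx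
    obtain ⟨hxX, hxd⟩ := mem_filter.1 hx1
    rw [mem_insert, not_or] at hx2
    refine ⟨hxX, hxd, hx2.1, fun ok hok hxe => hx2.2 ?_⟩
    rw [List.mem_toFinset, List.mem_map]; exact ⟨ok, hok, hxe.symm⟩
  have hN1 : ∀ x ∈ N, dist x c = 1 ∧ x ≠ z ∧ 1 ≤ dist x z ∧
      ∀ ok ∈ pocketObst tid, x ≠ z + A (Qr (iptQ ok.1.toV)) ∧ ObstCond' ok.2 (dist x (z + A (Qr (iptQ ok.1.toV)))) := by
    intro x hx
    obtain ⟨hxX, hxd, hxz, hxo⟩ := hNmem x hx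
    refine ⟨hxd, hxz, hyp.sep x hxX z hyp.bmem hxz, fun ok hok => ?_⟩
    rw [hpos]
    refine ⟨hxo ok hok, ?_⟩
    obtain ⟨hP, hPsat, -⟩ := hobX ok hok
    unfold ObstCond'
    split_ifs with h01
    · obtain ⟨hPX, hP12⟩ := hinv.sat _ (hPsat h01)
      rcases eq_or_dist_eq_one_or_le_dist_of_saturated hyp.gap hyp.sep hPX hP12 hxX with h | h | h
      · exact absurd h (hxo ok hok)
      · exact Or.inl (by rw [dist_comm]; exact h)
      · exact Or.inr (by rw [dist_comm]; linarith)
    · exact hyp.sep x hxX _ (hinv.pres _ hP) (hxo ok hok)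
  have hN2 : ∀ x ∈ N, ∀ x' ∈ N, x ≠ x' → 1 ≤ dist x x' := fun x hx x' hx' hne => hyp.sep x (hNmem x hx).1 x' (hNmem x' hx').1 hne
  have hle := hrow A z c N hzc hcob hcpin hN1 hN2
  -- count the contacts of `c`
  set Cc := X.filter fun x => dist x c = 1 with hCc
  set O := ((pocketObst tid).map fun ok => TT G' q₀ (Q3.add bG (msymQ ns ok.1))).toFinset with hO
  have hCc12 : Cc.card = 12 := by
    rw [hCc, ← hc12]; congr 1; ext x; simp only [mem_filter, dist_comm]
  have hsub : Cc ⊆ N ∪ (insert z (O.filter fun P => dist c P = 1)) := by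
    intro x hx
    by_cases hxN : x ∈ N
    · exact mem_union_left _ hxN
    · refine mem_union_right _ ?_
      have hx' : x ∈ insert z O := by
        by_contra hno
        exact hxN (mem_sdiff.2 ⟨hx, hno⟩)
      rw [mem_insert] at hx' ⊢
      rcases hx' with rfl | hxO
      · exact Or.inl rfl
      · exact Or.inr (mem_filter.2 ⟨hxO, by rw [dist_comm]; exact (mem_filter.1 hx).2⟩)
  have hOle : (O.filter fun P => dist c P = 1).card ≤ ((pocketObst tid).filter fun ok => dist c (z + A (Qr (iptQ ok.1.toV))) = 1).length := by
    have heq : (O.filter fun P => dist c P = 1) =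
        ((((pocketObst tid).filter fun ok => dist c (z + A (Qr (iptQ ok.1.toV))) = 1).map fun ok => TT G' q₀ (Q3.add bG (msymQ ns ok.1))).toFinset) := by
      ext P
      simp only [hO, mem_filter, List.mem_toFinset, List.mem_map, List.mem_filter, decide_eq_true_eq]
      constructor
      · rintro ⟨⟨ok, hok, rfl⟩, hd⟩; exact ⟨ok, ⟨hok, by rw [hpos]; exact hd⟩, rfl⟩
      · rintro ⟨ok, ⟨hok, hd⟩, rfl⟩; exact ⟨⟨ok, hok, rfl⟩, by rw [hpos] at hd; exact hd⟩
    rw [heq]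
    exact (List.toFinset_card_le _).trans (by rw [List.length_map])
  have hcard := (card_le_card hsub).trans (card_union_le _ _)
  have hins : (insert z (O.filter fun P => dist c P = 1)).card ≤ (O.filter fun P => dist c P = 1).card + 1 := card_insert_le _ _
  omega

/-! ### §9 Soundness of the checker -/

open scoped Classical in
/-- **SOUNDNESS.**  No certificate is accepted from a state interpreted in `X`. -/
theorem runG_sound (hyp : HypG X G' q₀) : ∀ (c : C) (st : St), InvG X G' q₀ st → runG c st = true → False := by
  intro c
  induction c with
  | leaf w => intro st hinv h; exact false_of_checkWG hyp hinv w h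
  | e1 p κ j kF k1 k2 ihF ih1 ih2 =>
    intro st hinv h
    simp only [runG, Bool.and_eq_true, decide_eq_true_eq] at h
    obtain ⟨⟨⟨⟨hj, hp⟩, hstar⟩, hF⟩, htw⟩ := h
    obtain ⟨hpX, hp12⟩ := hinv.sat p hp
    have hstar' := star_of_starOKG hinv (j := ⟨j, hj⟩) hstar
    rcases e1_step G' q₀ hyp.e1 hyp.sep hp12 (frameOf κ) ⟨j, hj⟩ hstar' with ⟨hall, hcont⟩ | ⟨c, hown, hownX, hmir, hfar, hcont⟩
    · exact ihF _ (inv_addFullG hinv hp hall hcont) hF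
    · have hc : (c : ℕ) ∈ (List.range 8).filter (ownSide j) := List.mem_filter.2 ⟨List.mem_range.2 c.2, ownSide_of ⟨j, hj⟩ c hown⟩
      split at htw
      · rename_i c₁ c₂ heq
        rw [heq] at hc
        simp only [Bool.and_eq_true] at htw
        simp only [List.mem_cons, List.not_mem_nil, or_false] at hc
        rcases hc with hc | hc
        · exact ih1 _ (hc ▸ inv_addTwinG hinv hp hownX hmir hfar hcont) htw.1
        · exact ih2 _ (hc ▸ inv_addTwinG hinv hp hownX hmir hfar hcont) htw.2
      · exact Bool.false_ne_true htw
  | split x kU kS ihU ihS =>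
    intro st hinv h
    simp only [runG, Bool.and_eq_true, decide_eq_true_eq, Bool.not_eq_true', decide_eq_false_iff_not] at h
    obtain ⟨⟨⟨⟨hx, hd⟩, hne⟩, hU⟩, hS⟩ := h
    have hxX := hinv.pres x hx
    have hdist : dist (TT G' q₀ bG) (TT G' q₀ x) = 1 := (dist_TT_eq_one_iff G' q₀ bG x).2 hd
    by_cases h12 : (X.filter fun z => dist (TT G' q₀ x) z = 1).card = 12
    · exact ihS _ (inv_satG hinv hx hxX h12) hS
    · have hle : (X.filter fun z => dist (TT G' q₀ x) z = 1).card ≤ 11 := by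
        have := card_filter_dist_eq_one_le_twelve X hyp.sep (TT G' q₀ x); omega
      cases hu : st.uns with
      | none => rw [hu] at hU; exact ihU _ (inv_unsG hinv hx hd hle) hU
      | some u =>
        obtain ⟨hup, hud, hule⟩ := hinv.uns u hu
        have heq := hyp.one _ hxX _ (hinv.pres u hup) hdist ((dist_TT_eq_one_iff G' q₀ bG u).2 hud) hle hule
        exact hne (by rw [hu, TT_injective G' q₀ heq])
  | pres v kP kA ihP ihA =>
    intro st hinv h
    simp only [runG, Bool.and_eq_true, Bool.not_eq_true', decide_eq_false_iff_not] at h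
    obtain ⟨⟨_, hP⟩, hA⟩ := h
    by_cases hx : TT G' q₀ v ∈ X
    · exact ihP _ (inv_insertG hinv hx) hP
    · exact ihA _ (inv_empG hinv hx) hA
  | vac k => intro st hinv h; exact false_of_vacG hyp hinv h
  | hv k i j l y ns => intro st hinv h; exact false_of_hvG hyp hinv h
  | hb y ns => intro st hinv h; exact false_of_hbG hyp hinv h
  | pocket tid ns => intro st hinv h; exact false_of_pocketG hyp hinv h

end GlideCensus

end TailResidue

end Summit.Ventures.Crystal3D.Theorems

end
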